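import Mathlib.Topology.Algebra.Module.FiniteDimension
import Literature.MathematicalPhysics.QuantumFieldTheory.YangMillsOS
import HarnessLib

/-!
# Bałaban's renormalisation step as a parabolic map in Banach coordinates (hypothesis structure)

`BalabanBanachStep G r M` is a HYPOTHESIS STRUCTURE (in the manner of
`Literature.MathematicalPhysics.QuantumLattice.BlockRGScheme` and `AxialGaugeYMRegularisation`:
data + the properties consumers use, NO existence claim inside). It posits that ONE complete
renormalisation transformation of four-dimensional pure lattice gauge theory with compact gauge
group `G`, Wilson action in the faithful unitary representation `r`, block factor `M` —
Bałaban's `ρ_{k+1} = R T ρ_k`, `(Tρ)(V) = ∫ dU δ(Ū V⁻¹) ρ(U)` [Balaban1988Convergent (0.1) and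
Thm. 1 p. 262; Balaban1987RG1 (0.1)–(0.3); Balaban1989LargeFieldII Thm. 1; Dimock2013 §1.2–§2.1
for the scalar re-exposition "block average, then rescale to the unit lattice"] — is realised as
a map `F(g, y) = (φ g y, Ψ g y)` on `ℝ × E`, `E` a real Banach space ("quasi-local gauge-invariant
irrelevant action functionals on unit-lattice gauge fields, vacuum energy quotiented out"), in
which the running coupling `g` is the PARABOLIC direction, `φ g y = g + b g³ + O(g⁴ + g³‖y‖)`
with `b = b₀ log M > 0` (asymptotic freedom: the bare coupling at spacing `ε` behaves as
`(a + b log ε⁻¹)^{-1/2}` [Balaban1988Convergent, p. 244]), and `y` contracts,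
`Ψ g y = A y + O(g² + ‖y‖²)`, `‖A‖ ≤ θ < 1`. Bałaban himself remarks that his Theorem 1 may be
read as "the operation RT transforms the space [of densities] with the index k into the space
with the index k + 1" [Balaban1988Convergent, p. 262, second remark]; the structure is the
Banach-chart form of that remark wanted by route `ParabolicTrajectory` of `YangMills`
(item `BalabanStepParabolic`: `∀ G r, ∃ M₀, ∀ M ≥ M₀, Nonempty (BalabanBanachStep G r M)` is the
route's crux — an open problem, NOT asserted here).

## Fields (four groups)

1. the chart: `E` with its Banach-space instances;
2. the step `φ, Ψ, A` and constants `b θ C δ` with, VERBATIM, the hypothesis block of the route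
   decl `Summit.QuantumFields.YangMills.Theses.ParabolicTrajectory.ParabolicCentreCurve`
   (`b_pos … lipschitz_base`; `parabolicHypotheses` repackages them in the route's order, so that
   `hPCC S.E S.φ S.Ψ S.A S.b S.θ S.C S.δ` applied to the nine components yields the centre curve),
   and the normalisation `b = b₀ * Real.log M` (`b₀` = one-loop coefficient of `(G, r)`,
   recorded not computed);
3. the basin: radius `R ≥ δ`, uniform fibre contraction `θ' < 1` of `Ψ g ·` on the `R`-ball,
   the parabolic remainder bound for `φ` on the `R`-ball, and the Wilson embedding
   `g ↦ (g, yW g)`, `g ∈ [0, g₀]`, continuous with `‖yW g‖ ≤ R`, together with the inverse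
   bare coupling `betaOf : (0, g₀] → ℝ` (strictly decreasing, continuous, `→ ∞` at `0⁺`) and
   unit-scale multiplicative normalisations `c g s` (`= 1` on the curvature species);
4. the realisation functional `expect p S n σ f`: the smeared, renormalised `n`-point function
   of the species string `σ` with test functions `f` in the effective unit-lattice theory `p`
   on the torus of `S` sites per direction, with (4a) exact RG covariance `expect (F p) S … f =
   expect p (M S) … (f ∘ M⁻¹)`, (4b) identification with Wilson's lattice theory at the points
   `(g, yW g)`, (4c) continuity on the chart `[0, δ] × B̄_R` for off-diagonal tuples.

## Exact forms fixed here (the request left them to the implementer) and deviations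

* (4a) test functions transform by PURE DILATION `f ↦ f ∘ (M⁻¹ • ·)` (`blockDilate`), with no
  per-species factor: at unit scale every species is smeared with the canonical dimension-four
  bookkeeping `∑ₓ f(x) (O(τₓU) − ⟨O⟩)`, so the Riemann factor `M⁻⁴` and the canonical scaling
  `M⁴` of a dimension-`4 = d` density cancel; iterating, the orbit of the Wilson point at bare
  coupling `g` realises the `a⁻⁴`-renormalised lattice `n`-point functions at spacing
  `a = M^{-j}` (finite `g`-dependent renormalisations live in `c g s`). Free per-species
  factors `λ_s` would admit the degenerate instances `λ_s < 1` (all orbit values tend to `0`),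
  making `Nonempty` vacuous.
* (4b) the additive normalisation is EXACT CENTRING by the torus Wilson mean
  (`wilsonTorusMean`), not a fixed constant `m s`: with any fixed `m` the one-point orbit values
  `c · M^{4j} (⟨O⟩_β − m)` are unbounded along tuned orbits and contradict (4c), so no instance
  could exist; centring is the observable counterpart of "vacuum energy quotiented out".
  `c : ℝ → YMSpecies G → ℝ` may depend on the bare coupling (finite `Z`-factors) but is pinned
  to `1` on `r.curvature` (else `c → 0` trivialises the content); (4b) is imposed for
  `g ∈ (0, g₀]` (at `g = 0` there is no Wilson measure) and `betaOf` is only constrained there.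
* (4c) continuity is required for tuples whose tensor product lies in `⁰𝒮`
  (`IsOffDiagonal (tensorFin n (ofRealTest ∘ f))`, the class used by `IsYangMillsFor`):
  at coinciding points contact terms diverge and continuity would be false for every instance.
* basin: `δ ≤ R` (the "big ball" contains the chart ball) and the parabolic bound on `φ` is
  also imposed on the `R`-ball (`remainder_basin`); without it `φ` is unconstrained at the
  Wilson points (`‖yW g‖ > δ` allowed) and orbits could leave the chart at the first step.
  `0 ≤ θ'` is recorded. Rescaling the norm of `E` shows `δ ≤ R` loses no generality.
* `betaOf` is the bare inverse coupling of the chart coupling: `|betaOf g − κ/g²| ≤ K` on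
  `(0, g₀]` for recorded constants `κ > 0`, `K` (Bałaban's `ρ₀ = exp[−(1/g₀²)A − E]`: the chart
  coupling of Wilson's action IS its bare coupling, up to the `O(1)` reparametrisation slack),
  strictly decreasing and continuous, hence onto every large `β` (`tendsto_betaOf`; a Wilson
  sequence `β_k → ∞` is a sequence of Wilson points `g_k → 0⁺`). A free `betaOf` would admit
  degenerate instances (`β(g)` growing so fast that every orbit value is a frozen-lattice
  moment, trivially continuous), making `Nonempty` vacuous; a bounded one would be useless.
* `blockDilate 0` is the identity (junk value; `b = b₀ log M > 0` forces `2 ≤ M`, `two_le_M`).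
* Parity of `M`: (4b) speaks about the odd tori `2L+1` of the tree's `latticeSchwinger`
  (centred fundamental domain `box 4 L`), and (4a) links the torus of `S` sites to the torus of
  `M S` sites; the Wilson content therefore propagates along orbits only when `M` is odd —
  blocks centred at sites, as in Bałaban and Dimock ("we assume L is odd", Dimock 2013 §2.1).
  Consumers take `M` odd; nothing here requires it.

## What is NOT here

No existence statement, no value of `b₀` (the tree's `afCoefficient` records `11N/(48π²)` for
`SU(N)` in its own convention), no large-field/small-field decomposition, no claim that
Bałaban's densities determine fine-lattice correlations: all of that is the burden of whoever
inhabits the structure.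
-/

open scoped SchwartzMap
open MeasureTheory Filter Topology
open Literature.MathematicalPhysics.AQFT Literature.MathematicalPhysics.QuantumLattice
open Literature.Probability.LatticeModels

noncomputable section

namespace Literature.MathematicalPhysics.QuantumFieldTheory

/-! ### Dilation of test functions by the block factor -/

/-- **Block dilation of a test function**: `blockDilate M f = f ∘ (M⁻¹ • ·)`, i.e.
`(blockDilate M f)(x) = f(x / M)`, as a continuous linear map of the Schwartz space (Mathlib
`SchwartzMap.compCLMOfContinuousLinearEquiv` along the dilation `x ↦ M⁻¹ x`). A test function
on the coarse unit lattice is read on the fine unit lattice (`M` fine sites per coarse site and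
direction) through this map (Dimock 2013 §2.1, `Φ_{1,L}(x) = L^{-1/2} Φ₁(x/L)`, here without the
field-strength factor). For `M = 0` the junk value is the identity. [cite: Dimock2013, §2.1] -/
def blockDilate (M : ℕ) :
    𝓢(EuclideanSpace ℝ (Fin 4), ℝ) →L[ℝ] 𝓢(EuclideanSpace ℝ (Fin 4), ℝ) :=
  if hM : M = 0 then ContinuousLinearMap.id ℝ _
  else
    SchwartzMap.compCLMOfContinuousLinearEquiv ℝ
      ((LinearEquiv.smulOfNeZero ℝ (EuclideanSpace ℝ (Fin 4)) ((M : ℝ)⁻¹)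
          (inv_ne_zero (Nat.cast_ne_zero.2 hM))).toContinuousLinearEquiv)

/-- `(blockDilate M f)(x) = f (M⁻¹ • x)` for `M ≠ 0`. [folklore] -/
@[simp] theorem blockDilate_apply {M : ℕ} (hM : M ≠ 0) (f : 𝓢(EuclideanSpace ℝ (Fin 4), ℝ))
    (x : EuclideanSpace ℝ (Fin 4)) : blockDilate M f x = f ((M : ℝ)⁻¹ • x) := by
  simp only [blockDilate, hM, ↓reduceDIte, SchwartzMap.compCLMOfContinuousLinearEquiv_apply,
    Function.comp_apply, LinearEquiv.coe_toContinuousLinearEquiv', LinearEquiv.smulOfNeZero_apply]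

/-- `blockDilate 0` is the identity (junk value). [folklore] -/
@[simp] theorem blockDilate_zero : blockDilate 0 = ContinuousLinearMap.id ℝ _ := by
  simp [blockDilate]

/-! ### Centred unit-lattice Wilson `n`-point functions -/

section Wilson

variable {G : Type} [Group G] [MeasurableSpace G] [TopologicalSpace G] [IsTopologicalGroup G]
  [CompactSpace G] [BorelSpace G] {N : ℕ}

/-- **Torus Wilson mean** `⟨O⟩_{β, 2L+1} = ∫ O(Ũ) dμ_{β}(U)` of an observable `O` of the
infinite lattice, under Wilson's measure at inverse coupling `β` on the torus of side `2L+1`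
(`Ũ` the periodic lift). It is the additive normalisation (exact centring) of the unit-scale
fields below. [cite: Wilson1974] [cite: OsterwalderSeiler1978, §2] -/
def wilsonTorusMean (ρ : G →* Matrix (Fin N) (Fin N) ℂ) (β : ℝ) (L : ℕ)
    (O : LGConfig 4 G → ℝ) : ℝ :=
  ∫ U, O (torusLift (2 * L + 1) U) ∂(wilsonMeasure (d := 4) (L := 2 * L + 1) ρ β)

/-- **Centred unit-lattice Wilson `n`-point function** of the species string `σ` on the torus of
side `2L+1` at inverse coupling `β`, with multiplicative normalisations `c`:
`∫ ∏ᵢ [c(σᵢ) ∑_{x ∈ box L} fᵢ(x) (σᵢ(τₓŨ) − ⟨σᵢ⟩_{β,2L+1})] dμ_β(U)` — the tree's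
`smearedLatticeField` at spacing `1`, centred by `wilsonTorusMean` (so all one-point functions
vanish). [cite: JaffeWitten2000, §6] [cite: OsterwalderSeiler1978, §2] -/
def wilsonCentredSchwinger (ρ : G →* Matrix (Fin N) (Fin N) ℂ) (β : ℝ) (L : ℕ)
    (c : YMSpecies G → ℝ) (n : ℕ) (σ : Fin n → YMSpecies G)
    (f : Fin n → 𝓢(EuclideanSpace ℝ (Fin 4), ℝ)) : ℝ :=
  ∫ U, ∏ i, smearedLatticeField (σ i).F (box 4 L) 1 (c (σ i))
      (wilsonTorusMean ρ β L (σ i).F) (f i) (torusLift (2 * L + 1) U)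
    ∂(wilsonMeasure (d := 4) (L := 2 * L + 1) ρ β)

/-- With no fields the centred `0`-point function is the total mass of Wilson's measure
(`= 1` whenever it is a probability measure). [folklore] -/
theorem wilsonCentredSchwinger_zero (ρ : G →* Matrix (Fin N) (Fin N) ℂ) (β : ℝ) (L : ℕ)
    (c : YMSpecies G → ℝ) (σ : Fin 0 → YMSpecies G)
    (f : Fin 0 → 𝓢(EuclideanSpace ℝ (Fin 4), ℝ)) :
    wilsonCentredSchwinger ρ β L c 0 σ f =
      (wilsonMeasure (d := 4) (L := 2 * L + 1) ρ β).real Set.univ := by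
  simp [wilsonCentredSchwinger]

end Wilson

/-! ### The hypothesis structure -/

/-- **Bałaban's complete renormalisation step as a Lipschitz parabolic map in Banach
coordinates** — HYPOTHESIS STRUCTURE over the gauge group `G`, the lattice representation `r`
(Wilson's action) and the block factor `M`; no existence claim inside (inhabiting it is the
crux `BalabanStepParabolic` of route `ParabolicTrajectory`). Data: a real Banach space `E`;
the step `(g, y) ↦ (φ g y, Ψ g y)` with linear part `A` in the fibre and constants `b θ C δ`
satisfying VERBATIM the hypothesis block of the route decl `ParabolicCentreCurve`
(`φ g y = g + b g³ + O(g⁴ + g³‖y‖)`, `Ψ g y = A y + O(g² + ‖y‖²)`, `‖A‖ ≤ θ < 1`, Lipschitz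
remainders), `b = b₀ log M` [Balaban1988Convergent, p. 244: bare coupling
`(a + b log ε⁻¹)^{-1/2}`; Balaban1987RG1 (0.3), (0.18)–(0.20), (0.33): the recursive
coupling renormalisation and its window]; a basin of radius `R ≥ δ` on which `Ψ g ·` contracts
uniformly and `φ` stays parabolic, containing the Wilson actions `(g, yW g)`, `g ∈ [0, g₀]`, at inverse bare coupling
`betaOf g = κ/g² + O(1)` [Balaban1988Convergent Thm. 1: `ρ₀ = exp[−(1/g₀²)A − E]` is in the
inductive space]; and a
realisation functional `expect` (smeared renormalised `n`-point functions of the effective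
unit-lattice theories) which is exactly RG-covariant under the step with block dilation of the
test functions [Balaban1988Convergent (0.1); Dimock2013 §2.1], equals the centred unit-lattice
Wilson `n`-point functions `wilsonCentredSchwinger r.ρ (betaOf g) L (c g)` at the Wilson points,
and is continuous on the chart `[0, δ] × B̄_R` for off-diagonal tuples of test functions. See
the module docstring for the exact forms fixed here and why. [cite: Balaban1988Convergent, (0.1) and Thm. 1 p. 262 (with the second remark)] [cite: Balaban1987RG1, (0.1)–(0.3)] [cite: Balaban1989LargeFieldII, Thm. 1] [cite: Dimock2013, §1.2–§2.1] -/
structure BalabanBanachStep (G : Type) [Group G] [TopologicalSpace G] [IsTopologicalGroup G]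
    [CompactSpace G] [MeasurableSpace G] [BorelSpace G] (r : LatticeRep G) (M : ℕ) where
  /-- (1) The chart: irrelevant gauge-invariant quasi-local action functionals on unit-lattice
  gauge fields, vacuum energy quotiented out. -/
  E : Type
  [instNormedAddCommGroup : NormedAddCommGroup E]
  [instNormedSpace : NormedSpace ℝ E]
  [instCompleteSpace : CompleteSpace E]
  /-- (2) The coupling renormalisation `g ↦ φ g y` of one complete step. -/
  φ : ℝ → E → ℝ
  /-- The step in the irrelevant directions. -/
  Ψ : ℝ → E → E
  /-- The linearisation of `Ψ 0 ·` at the free fixed point `(0, 0)`. -/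
  A : E →L[ℝ] E
  /-- Parabolic coefficient: `φ g 0 = g + b g³ + O(g⁴)`. -/
  b : ℝ
  /-- Contraction rate of the irrelevant directions. -/
  θ : ℝ
  /-- The common constant of the remainder bounds. -/
  C : ℝ
  /-- Radius of the chart (in `g` and in `y`) on which the normal form holds. -/
  δ : ℝ
  -- the hypothesis block of `ParabolicCentreCurve`, verbatim
  b_pos : 0 < b
  θ_nonneg : 0 ≤ θ
  θ_lt_one : θ < 1
  C_pos : 0 < C
  δ_pos : 0 < δ
  norm_A_le : ‖A‖ ≤ θ
  remainder : ∀ g : ℝ, ∀ y : E, |g| ≤ δ → ‖y‖ ≤ δ →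
    |φ g y - (g + b * g ^ 3)| ≤ C * (g ^ 4 + |g| ^ 3 * ‖y‖) ∧
      ‖Ψ g y - A y‖ ≤ C * (g ^ 2 + ‖y‖ ^ 2)
  lipschitz_fibre : ∀ g : ℝ, ∀ y y' : E, |g| ≤ δ → ‖y‖ ≤ δ → ‖y'‖ ≤ δ →
    |φ g y - φ g y'| ≤ C * |g| ^ 3 * ‖y - y'‖ ∧
      ‖Ψ g y - Ψ g y' - A (y - y')‖ ≤ C * (|g| + ‖y‖ + ‖y'‖) * ‖y - y'‖
  lipschitz_base : ∀ g g' : ℝ, ∀ y : E, |g| ≤ δ → |g'| ≤ δ → ‖y‖ ≤ δ →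
    |φ g y - φ g' y - (g - g') - b * (g ^ 3 - g' ^ 3)| ≤
        C * (max |g| |g'|) ^ 2 * (max |g| |g'| + ‖y‖) * |g - g'| ∧
      ‖Ψ g y - Ψ g' y‖ ≤ C * (|g| + |g'| + ‖y‖) * |g - g'|
  /-- The one-loop coefficient of `(G, r)` (recorded, not computed). -/
  b₀ : ℝ
  /-- `b = b₀ log M`: one block step of factor `M` shifts `g⁻²` by `−2 b₀ log M + O(g²)`. -/
  b_eq : b = b₀ * Real.log M
  /-- (3) Radius of the basin (the "big ball"). -/
  R : ℝ
  δ_le_R : δ ≤ R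
  /-- Uniform contraction rate of the fibre maps `Ψ g ·` on the basin. -/
  θ' : ℝ
  θ'_nonneg : 0 ≤ θ'
  θ'_lt_one : θ' < 1
  contraction : ∀ g : ℝ, ∀ y y' : E, |g| ≤ δ → ‖y‖ ≤ R → ‖y'‖ ≤ R →
    ‖Ψ g y - Ψ g y'‖ ≤ θ' * ‖y - y'‖
  remainder_basin : ∀ g : ℝ, ∀ y : E, |g| ≤ δ → ‖y‖ ≤ R →
    |φ g y - (g + b * g ^ 3)| ≤ C * (g ^ 4 + |g| ^ 3 * ‖y‖)
  /-- The Wilson embedding: `(g, yW g)` are the coordinates of Wilson's action at bare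
  coupling `g`. -/
  yW : ℝ → E
  /-- The range `[0, g₀]` of bare couplings on which the Wilson embedding is controlled. -/
  g₀ : ℝ
  g₀_pos : 0 < g₀
  continuousOn_yW : ContinuousOn yW (Set.Icc 0 g₀)
  norm_yW_le : ∀ g ∈ Set.Icc 0 g₀, ‖yW g‖ ≤ R
  /-- The inverse bare coupling `β(g)` of the tree's `wilsonMeasure r.ρ β` as a function of the
  chart coupling `g ∈ (0, g₀]` (`β ∼ κ/g²`). -/
  betaOf : ℝ → ℝ
  strictAntiOn_betaOf : StrictAntiOn betaOf (Set.Ioc 0 g₀)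
  continuousOn_betaOf : ContinuousOn betaOf (Set.Ioc 0 g₀)
  /-- The constant of `β(g) = κ/g² + O(1)` (normalisation of the invariant form of `(G, r)`
  against the tree's Wilson weight `exp(−β ∑ₚ (N − Re tr ρ(U_p)))`; recorded, not computed). -/
  κ : ℝ
  κ_pos : 0 < κ
  /-- The `O(1)` of `β(g) = κ/g² + O(1)`. -/
  K : ℝ
  betaOf_sub_le : ∀ g ∈ Set.Ioc 0 g₀, |betaOf g - κ / g ^ 2| ≤ K
  /-- Unit-scale multiplicative normalisations of the species at bare coupling `g`. -/
  c : ℝ → YMSpecies G → ℝ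
  c_curvature : ∀ g : ℝ, c g r.curvature = 1
  /-- (4) The realisation functional: `expect p S n σ f` is the smeared, renormalised `n`-point
  function of the species string `σ` with test functions `f` in the effective unit-lattice
  theory `p = (g, y)` on the torus of `S` sites per direction. -/
  expect : ℝ × E → ℕ → (n : ℕ) → (Fin n → YMSpecies G) →
    (Fin n → 𝓢(EuclideanSpace ℝ (Fin 4), ℝ)) → ℝ
  /-- (4a) exact RG covariance: the step preserves the long-distance observables, the coarse
  torus of `S` sites being the fine torus of `M S` sites read through block dilation. -/
  expect_step : ∀ (g : ℝ) (y : E), g ∈ Set.Icc 0 δ → ‖y‖ ≤ R →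
    ∀ (S n : ℕ) (σ : Fin n → YMSpecies G) (f : Fin n → 𝓢(EuclideanSpace ℝ (Fin 4), ℝ)),
      expect (φ g y, Ψ g y) S n σ f = expect (g, y) (M * S) n σ (fun i => blockDilate M (f i))
  /-- (4b) identification with Wilson's lattice theory at the Wilson points. -/
  expect_wilson : ∀ g ∈ Set.Ioc 0 g₀,
    ∀ (L n : ℕ) (σ : Fin n → YMSpecies G) (f : Fin n → 𝓢(EuclideanSpace ℝ (Fin 4), ℝ)),
      expect (g, yW g) (2 * L + 1) n σ f = wilsonCentredSchwinger r.ρ (betaOf g) L (c g) n σ f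
  /-- (4c) continuity of the observables on the chart, for off-diagonal tuples. -/
  continuousOn_expect : ∀ (S n : ℕ) (σ : Fin n → YMSpecies G)
    (f : Fin n → 𝓢(EuclideanSpace ℝ (Fin 4), ℝ)),
      IsOffDiagonal (SchwartzMap.tensorFin n fun i => ofRealTest (f i)) →
        ContinuousOn (fun p : ℝ × E => expect p S n σ f) (Set.Icc 0 δ ×ˢ Metric.closedBall 0 R)

namespace BalabanBanachStep

attribute [instance] instNormedAddCommGroup instNormedSpace instCompleteSpace

variable {G : Type} [Group G] [TopologicalSpace G] [IsTopologicalGroup G] [CompactSpace G]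
  [MeasurableSpace G] [BorelSpace G] {r : LatticeRep G} {M : ℕ} (S : BalabanBanachStep G r M)

/-- **The hypothesis block of `ParabolicCentreCurve` as one conjunction**, in the order of the
route decl: feeding its nine components to
`Summit.QuantumFields.YangMills.Theses.ParabolicTrajectory.ParabolicCentreCurve` at
`(S.E, S.φ, S.Ψ, S.A, S.b, S.θ, S.C, S.δ)` yields the centre-unstable curve and its attraction. [folklore] -/
theorem parabolicHypotheses :
    0 < S.b ∧ 0 ≤ S.θ ∧ S.θ < 1 ∧ 0 < S.C ∧ 0 < S.δ ∧ ‖S.A‖ ≤ S.θ ∧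
    (∀ g : ℝ, ∀ y : S.E, |g| ≤ S.δ → ‖y‖ ≤ S.δ →
      |S.φ g y - (g + S.b * g ^ 3)| ≤ S.C * (g ^ 4 + |g| ^ 3 * ‖y‖) ∧
        ‖S.Ψ g y - S.A y‖ ≤ S.C * (g ^ 2 + ‖y‖ ^ 2)) ∧
    (∀ g : ℝ, ∀ y y' : S.E, |g| ≤ S.δ → ‖y‖ ≤ S.δ → ‖y'‖ ≤ S.δ →
      |S.φ g y - S.φ g y'| ≤ S.C * |g| ^ 3 * ‖y - y'‖ ∧
        ‖S.Ψ g y - S.Ψ g y' - S.A (y - y')‖ ≤ S.C * (|g| + ‖y‖ + ‖y'‖) * ‖y - y'‖) ∧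
    (∀ g g' : ℝ, ∀ y : S.E, |g| ≤ S.δ → |g'| ≤ S.δ → ‖y‖ ≤ S.δ →
      |S.φ g y - S.φ g' y - (g - g') - S.b * (g ^ 3 - g' ^ 3)| ≤
          S.C * (max |g| |g'|) ^ 2 * (max |g| |g'| + ‖y‖) * |g - g'| ∧
        ‖S.Ψ g y - S.Ψ g' y‖ ≤ S.C * (|g| + |g'| + ‖y‖) * |g - g'|) :=
  ⟨S.b_pos, S.θ_nonneg, S.θ_lt_one, S.C_pos, S.δ_pos, S.norm_A_le, S.remainder,
    S.lipschitz_fibre, S.lipschitz_base⟩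

/-- The step as a self-map of `ℝ × E`, `F (g, y) = (φ g y, Ψ g y)` — literally the map
iterated in `ParabolicCentreCurve`. [folklore] -/
def F (p : ℝ × S.E) : ℝ × S.E := (S.φ p.1 p.2, S.Ψ p.1 p.2)

/-- Unfolding `F`. [folklore] -/
@[simp] theorem F_apply (g : ℝ) (y : S.E) : S.F (g, y) = (S.φ g y, S.Ψ g y) := rfl

/-- `F` is the lambda of `ParabolicCentreCurve`. [folklore] -/
theorem F_eq : S.F = fun q : ℝ × S.E => (S.φ q.1 q.2, S.Ψ q.1 q.2) := rfl

/-- The basin contains the chart ball: `0 < δ ≤ R`. [folklore] -/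
theorem R_pos : 0 < S.R := S.δ_pos.trans_le S.δ_le_R

include S in
/-- `b = b₀ log M > 0` forces a genuine block factor, `2 ≤ M` (`log 0 = log 1 = 0`). [folklore] -/
theorem two_le_M : 2 ≤ M := by
  by_contra h
  have hb := S.b_pos
  rw [S.b_eq] at hb
  interval_cases M <;> simp at hb

include S in
/-- The block factor is non-zero. [folklore] -/
theorem M_ne_zero : M ≠ 0 := by have := S.two_le_M; omega

include S in
/-- `1 < M` as a real number. [folklore] -/
theorem one_lt_M : (1 : ℝ) < M := by have := S.two_le_M; exact_mod_cast this

/-- The one-loop coefficient is positive (asymptotic freedom is built into `0 < b`). [folklore] -/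
theorem b₀_pos : 0 < S.b₀ := by
  have hb := S.b_pos
  rw [S.b_eq] at hb
  exact pos_of_mul_pos_left hb (Real.log_nonneg S.one_lt_M.le)

/-- The free fixed point: `Ψ 0 0 = 0` (from the remainder bound at `g = 0`, `y = 0`). [folklore] -/
theorem Ψ_zero_zero : S.Ψ 0 0 = 0 := by
  have h := (S.remainder 0 0 (by simp [S.δ_pos.le]) (by simp [S.δ_pos.le])).2
  simpa using h

/-- The free fixed point: `φ 0 0 = 0`. [folklore] -/
theorem φ_zero_zero : S.φ 0 0 = 0 := by
  have h := (S.remainder 0 0 (by simp [S.δ_pos.le]) (by simp [S.δ_pos.le])).1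
  simpa using h

/-- `‖Ψ g 0‖ ≤ C g²` on the chart (the fibre image of the origin is second order in `g`). [folklore] -/
theorem norm_Ψ_zero_le {g : ℝ} (hg : |g| ≤ S.δ) : ‖S.Ψ g 0‖ ≤ S.C * g ^ 2 := by
  have h := (S.remainder g 0 hg (by simp [S.δ_pos.le])).2
  simpa using h

/-- **A priori bound for the fibre map on the basin**: `‖Ψ g y‖ ≤ θ' ‖y‖ + C g²` for
`|g| ≤ δ`, `‖y‖ ≤ R` (contraction towards `Ψ g 0`, which is `O(g²)`). [folklore] -/
theorem norm_Ψ_le {g : ℝ} {y : S.E} (hg : |g| ≤ S.δ) (hy : ‖y‖ ≤ S.R) :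
    ‖S.Ψ g y‖ ≤ S.θ' * ‖y‖ + S.C * g ^ 2 := by
  have h1 := S.contraction g y 0 hg hy (by simp [S.R_pos.le])
  have h2 := S.norm_Ψ_zero_le hg
  calc ‖S.Ψ g y‖ = ‖(S.Ψ g y - S.Ψ g 0) + S.Ψ g 0‖ := by rw [sub_add_cancel]
    _ ≤ ‖S.Ψ g y - S.Ψ g 0‖ + ‖S.Ψ g 0‖ := norm_add_le _ _
    _ ≤ S.θ' * ‖y - 0‖ + S.C * g ^ 2 := add_le_add h1 h2
    _ = S.θ' * ‖y‖ + S.C * g ^ 2 := by rw [sub_zero]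

/-- **Forward invariance of the basin in the fibre** for small couplings: if
`C g² ≤ (1 − θ') R` then `Ψ g` maps the `R`-ball into itself. [folklore] -/
theorem norm_Ψ_le_R {g : ℝ} {y : S.E} (hg : |g| ≤ S.δ) (hy : ‖y‖ ≤ S.R)
    (hsmall : S.C * g ^ 2 ≤ (1 - S.θ') * S.R) : ‖S.Ψ g y‖ ≤ S.R := by
  have h := S.norm_Ψ_le hg hy
  have hθ := S.θ'_nonneg
  nlinarith

/-- **Parabolic a priori bound for the coupling on the basin**:
`|φ g y − g| ≤ b |g|³ + C (g⁴ + |g|³ R)` for `|g| ≤ δ`, `‖y‖ ≤ R`. [folklore] -/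
theorem abs_φ_sub_le {g : ℝ} {y : S.E} (hg : |g| ≤ S.δ) (hy : ‖y‖ ≤ S.R) :
    |S.φ g y - g| ≤ S.b * |g| ^ 3 + S.C * (g ^ 4 + |g| ^ 3 * S.R) := by
  have h := S.remainder_basin g y hg hy
  have hC := S.C_pos.le
  have hg3 : 0 ≤ |g| ^ 3 := by positivity
  calc |S.φ g y - g| = |(S.φ g y - (g + S.b * g ^ 3)) + S.b * g ^ 3| := by ring_nf
    _ ≤ |S.φ g y - (g + S.b * g ^ 3)| + |S.b * g ^ 3| := abs_add_le _ _
    _ ≤ S.C * (g ^ 4 + |g| ^ 3 * ‖y‖) + S.b * |g| ^ 3 := by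
        refine add_le_add h ?_
        rw [abs_mul, abs_of_pos S.b_pos, abs_pow]
    _ ≤ S.C * (g ^ 4 + |g| ^ 3 * S.R) + S.b * |g| ^ 3 := by gcongr
    _ = S.b * |g| ^ 3 + S.C * (g ^ 4 + |g| ^ 3 * S.R) := by ring

/-- The Wilson points with `g ≤ min δ g₀` lie in the chart `[0, δ] × B̄_R` on which (4a) and
(4c) are stated. [folklore] -/
theorem wilson_mem_chart {g : ℝ} (hg0 : 0 ≤ g) (hgδ : g ≤ S.δ) (hg₀ : g ≤ S.g₀) :
    (g, S.yW g) ∈ Set.Icc 0 S.δ ×ˢ Metric.closedBall (0 : S.E) S.R := by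
  refine Set.mk_mem_prod ⟨hg0, hgδ⟩ ?_
  rw [Metric.mem_closedBall, dist_zero_right]
  exact S.norm_yW_le g ⟨hg0, hg₀⟩

/-- **Iterated RG covariance**: along an orbit segment that stays in the chart for `j` steps,
`expect (F^[j] p) S … f = expect p (M^j S) … (blockDilate M)^[j] ∘ f` — the effective theory
after `j` steps on the torus of `S` sites realises the same observables as the starting theory
on the torus of `M^j S` sites with `j`-fold dilated test functions. [folklore] -/
theorem expect_iterate (p : ℝ × S.E) (j : ℕ)
    (hp : ∀ i < j, (S.F^[i] p).1 ∈ Set.Icc 0 S.δ ∧ ‖(S.F^[i] p).2‖ ≤ S.R)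
    (T n : ℕ) (σ : Fin n → YMSpecies G) (f : Fin n → 𝓢(EuclideanSpace ℝ (Fin 4), ℝ)) :
    S.expect (S.F^[j] p) T n σ f =
      S.expect p (M ^ j * T) n σ (fun i => (blockDilate M)^[j] (f i)) := by
  induction j generalizing p T f with
  | zero => simp
  | succ j ih =>
    have h0 := hp 0 (Nat.succ_pos j)
    simp only [Function.iterate_zero, id_eq] at h0
    have hstep := S.expect_step p.1 p.2 h0.1 h0.2 (M ^ j * T) n σ
      (fun i => (blockDilate M)^[j] (f i))
    have harith : M * (M ^ j * T) = M ^ (j + 1) * T := by ring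
    have hf : (fun i => blockDilate M ((blockDilate M)^[j] (f i))) =
        fun i => (blockDilate M)^[j + 1] (f i) := by
      funext i; rw [Function.iterate_succ_apply']
    rw [Function.iterate_succ_apply, ih (S.F p) (fun i hi => ?_) T f]
    · rw [show S.F p = (S.φ p.1 p.2, S.Ψ p.1 p.2) from rfl, hstep, Prod.mk.eta, harith, hf]
    · have := hp (i + 1) (Nat.succ_lt_succ hi)
      simpa only [Function.iterate_succ_apply] using this

/-- At a Wilson point the `0`-point function is the mass of Wilson's measure (normalisation
check of (4b)). [folklore] -/
theorem expect_wilson_zero {g : ℝ} (hg : g ∈ Set.Ioc 0 S.g₀) (L : ℕ)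
    (σ : Fin 0 → YMSpecies G) (f : Fin 0 → 𝓢(EuclideanSpace ℝ (Fin 4), ℝ)) :
    S.expect (g, S.yW g) (2 * L + 1) 0 σ f =
      (wilsonMeasure (d := 4) (L := 2 * L + 1) r.ρ (S.betaOf g)).real Set.univ := by
  rw [S.expect_wilson g hg L 0 σ f, wilsonCentredSchwinger_zero]

/-- **`β(g) → ∞` as `g → 0⁺`** (from `β(g) ≥ κ/g² − K`): with continuity and strict
monotonicity, `betaOf` maps `(0, g₀]` onto `[betaOf g₀, ∞)`, so every Wilson theory at large
inverse coupling is a Wilson point of the chart. [folklore] -/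
theorem tendsto_betaOf : Tendsto S.betaOf (𝓝[>] 0) atTop := by
  have h1 : Tendsto (fun g : ℝ => S.κ * g⁻¹ + -S.K) (𝓝[>] 0) atTop :=
    tendsto_atTop_add_const_right _ _ (Tendsto.const_mul_atTop S.κ_pos tendsto_inv_nhdsGT_zero)
  refine tendsto_atTop_mono' _ ?_ h1
  have hmem : Set.Ioo (0 : ℝ) (min S.g₀ 1) ∈ 𝓝[>] (0 : ℝ) :=
    Ioo_mem_nhdsGT (lt_min S.g₀_pos one_pos)
  filter_upwards [hmem] with g hg
  have hg0 : 0 < g := hg.1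
  have hg₀ : g ≤ S.g₀ := (hg.2.trans_le (min_le_left _ _)).le
  have hg1 : g ≤ 1 := (hg.2.trans_le (min_le_right _ _)).le
  have hb := abs_le.1 (S.betaOf_sub_le g ⟨hg0, hg₀⟩)
  have hsq : g ^ 2 ≤ g := by nlinarith
  have hdiv : S.κ * g⁻¹ ≤ S.κ / g ^ 2 := by
    rw [div_eq_mul_inv]
    exact mul_le_mul_of_nonneg_left ((inv_le_inv₀ hg0 (by positivity)).2 hsq) S.κ_pos.le
  linarith [hb.1]

/-- `betaOf` is injective on `(0, g₀]`: distinct bare couplings are distinct Wilson theories. [folklore] -/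
theorem injOn_betaOf : Set.InjOn S.betaOf (Set.Ioc 0 S.g₀) := S.strictAntiOn_betaOf.injOn

end BalabanBanachStep

end Literature.MathematicalPhysics.QuantumFieldTheory

end
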